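import Literature.Analysis.FluidPDE.ElgindiEtaWeightedCoercivity
import HarnessLib

/-!
# The first transport coercivity estimate of Elgindi ([Elgindi2021] Corollary 6.8)

Topic `Literature/Analysis/FluidPDE`. Proof file (everything proved, no definitions, no named
facts) on the proof path of the named fact
`Literature.Analysis.FluidPDE.Elgindi.ElgindiGhoulMasmoudi2021_stabilityCore`
(`ElgindiStabilityDecomposition.lean`). T. M. Elgindi, Ann. of Math. 194 (2021) =
arXiv:1904.04795 (`[Elgindi2021]`), §6.1 **Corollary 6.8** (p. 17 of the held text):

> "If `α < 10⁻¹⁴` and `η = 99/100` we have: `10(𝓛_Γ^T(f)w, fw/sin(2θ)^η)_{L²} +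
> 10⁸(𝓛_Γ^T(f)w, fw)_{L²} + 10¹²((D_θ𝓛_Γ^T(f)), (D_θf)w²/sin(2θ)^γ)_{L²} ≥
> |f w/√(sin(2θ)^η)|²_{L²} + |(D_θf)w/√(sin(2θ)^γ)|²_{L²} + |fw|²_{L²}`. Proof. We combine the
> results of Propositions 6.4, 6.5, and 6.7."

Exactly that combination, with the vendored Propositions 6.4 (`transportL2Coercivity`), 6.5
(`thetaDerivativeCoercivity`) and 6.7 (`etaWeightedCoercivity`): `10·((1/5)X − 10⁶A) +
10⁸·((1/5)A − 100Y_w) + 10¹²·((¼ − α)Y − 10⁷αA) ≥ X + Y + A` for `α ≤ 10⁻¹⁴`, using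
`Y_w = ∬(D_θf·w)² ≤ Y = ∬(D_θf·w)²sin(2θ)^{−γ}` (`sin(2θ)^{−γ} ≥ 1`). Proved for `0 < α ≤ 10⁻¹⁴`
and `f ∈ C²` compactly supported inside the open strip with `L₁₂(f)(0) = 0`. This is the
`k = 0` level ("`E_θ^1`"-part) of the coercivity of `𝓛_Γ^T`; the `D_z`-derivative (Prop. 6.9,
Cor. 6.11) and the `𝓗ᵏ` induction (§6.3) follow in later files.
-/

noncomputable section

open MeasureTheory Set Function Real Filter
open _root_.Topology

namespace Literature.Analysis.FluidPDE

namespace Elgindi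

/-- `∬(D_θf·w)² ≤ ∬(D_θf·w)²sin(2θ)^{−γ}` (`sin(2θ)^{−γ} ≥ 1` on the strip), for `f ∈ C²`
compactly supported inside the open strip. [folklore] -/
theorem integral_sq_Dθ_le_weighted {α : ℝ} (hα : 0 ≤ α) {f : ℝ → ℝ → ℝ} (hf : ContDiff ℝ 2 (uncurry f))
    (hs : HasCompactSupport (uncurry f)) (hsub : tsupport (uncurry f) ⊆ strip) :
    ∫ p in strip, (Dθ f p.1 p.2 * radialWeight p.1) ^ 2 ≤
      ∫ p in strip, (Dθ f p.1 p.2 * radialWeight p.1) ^ 2 * Real.sin (2 * p.2) ^ (-gammaExp α) := by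
  have hgC : ContDiff ℝ 1 (uncurry (Dθ f)) := contDiff_Dθ (n := 1) hf hsub
  have i1 := integrableOn_sq_mul_radialWeight (hf.of_le (by norm_num)) hs hsub
    (F := fun p => Dθ f p.1 p.2) hgC.continuous.continuousOn fun p hp => Dθ_eq_zero_of_notMem_tsupport hp
  have i2 := integrableOn_mul_Dθ_weight (α := α) hf hs hsub (c := fun p : ℝ × ℝ => Dθ f p.1 p.2)
    hgC.continuous.continuousOn
  have e2 : ∫ p in strip, (Dθ f p.1 p.2 * radialWeight p.1) ^ 2 * Real.sin (2 * p.2) ^ (-gammaExp α) =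
      ∫ p in strip, Dθ f p.1 p.2 * Dθ f p.1 p.2 * radialWeight p.1 ^ 2 * Real.sin (2 * p.2) ^ (-gammaExp α) :=
    setIntegral_congr_fun measurableSet_strip fun p _ => by ring
  rw [e2]
  refine setIntegral_mono_on i1 i2 measurableSet_strip fun p hp => ?_
  have hsθ : 0 < Real.sin (2 * p.2) := Real.sin_pos_of_pos_of_lt_pi (by linarith [hp.2.1]) (by linarith [hp.2.2])
  have hρ1 : 1 ≤ Real.sin (2 * p.2) ^ (-gammaExp α) :=
    Real.one_le_rpow_of_pos_of_le_one_of_nonpos hsθ (Real.sin_le_one _) (by unfold gammaExp; linarith)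
  calc (Dθ f p.1 p.2 * radialWeight p.1) ^ 2 = (Dθ f p.1 p.2 * radialWeight p.1) ^ 2 * 1 := by ring
    _ ≤ (Dθ f p.1 p.2 * radialWeight p.1) ^ 2 * Real.sin (2 * p.2) ^ (-gammaExp α) :=
        mul_le_mul_of_nonneg_left hρ1 (sq_nonneg _)
    _ = Dθ f p.1 p.2 * Dθ f p.1 p.2 * radialWeight p.1 ^ 2 * Real.sin (2 * p.2) ^ (-gammaExp α) := by ring

/-- **Corollary 6.8 (first transport coercivity)** (Elgindi 2021, Corollary 6.8: "If `α < 10⁻¹⁴`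
and `η = 99/100` we have: `10(𝓛_Γ^T(f)w, fw/sin(2θ)^η) + 10⁸(𝓛_Γ^T(f)w, fw) +
10¹²((D_θ𝓛_Γ^T(f)), (D_θf)w²/sin(2θ)^γ) ≥ |fw/√(sin^η)|² + |(D_θf)w/√(sin^γ)|² + |fw|²`"), for
`0 < α ≤ 10⁻¹⁴` and `f ∈ C²` compactly supported inside the open strip with `L₁₂(f)(0) = 0`; by
combining the vendored Propositions 6.4, 6.5, 6.7. [cite: Elgindi2021, §6.1 Corollary 6.8 (p. 17 of arXiv:1904.04795)] -/
theorem firstTransportCoercivity {α : ℝ} (hα : 0 < α) (hα14 : α ≤ 1 / 10 ^ 14) {f : ℝ → ℝ → ℝ}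
    (hf : ContDiff ℝ 2 (uncurry f)) (hs : HasCompactSupport (uncurry f))
    (hsub : tsupport (uncurry f) ⊆ strip) (hL0 : L12 f 0 = 0) :
    (∫ p in strip, (f p.1 p.2 * radialWeight p.1) ^ 2 * Real.sin (2 * p.2) ^ (-eta)) +
        (∫ p in strip, (Dθ f p.1 p.2 * radialWeight p.1) ^ 2 * Real.sin (2 * p.2) ^ (-gammaExp α)) +
        (∫ p in strip, (f p.1 p.2 * radialWeight p.1) ^ 2) ≤
      10 * (∫ p in strip, opLΓT α f p.1 p.2 * f p.1 p.2 * radialWeight p.1 ^ 2 * Real.sin (2 * p.2) ^ (-eta)) +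
        10 ^ 8 * (∫ p in strip, opLΓT α f p.1 p.2 * f p.1 p.2 * radialWeight p.1 ^ 2) +
        10 ^ 12 * (∫ p in strip, Dθ (opLΓT α f) p.1 p.2 * Dθ f p.1 p.2 * radialWeight p.1 ^ 2 *
          Real.sin (2 * p.2) ^ (-gammaExp α)) := by
  have hα' : α ≤ 1 / 200 := hα14.trans (by norm_num)
  have h67 := etaWeightedCoercivity hα hα' hf hs hsub hL0
  have h64 := transportL2Coercivity hα.le hα' (hf.of_le (by norm_num)) hs hsub hL0
  have h65 := thetaDerivativeCoercivity hα hα' hf hs hsub hL0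
  have hYw := integral_sq_Dθ_le_weighted hα.le hf hs hsub
  set X : ℝ := ∫ p in strip, (f p.1 p.2 * radialWeight p.1) ^ 2 * Real.sin (2 * p.2) ^ (-eta) with hX
  set Y : ℝ := ∫ p in strip, (Dθ f p.1 p.2 * radialWeight p.1) ^ 2 * Real.sin (2 * p.2) ^ (-gammaExp α) with hY
  set A : ℝ := ∫ p in strip, (f p.1 p.2 * radialWeight p.1) ^ 2 with hA
  set Yw : ℝ := ∫ p in strip, (Dθ f p.1 p.2 * radialWeight p.1) ^ 2 with hYw'
  have hA0 : 0 ≤ A := integral_nonneg fun p => sq_nonneg _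
  have hX0 : 0 ≤ X := by
    simp only [hX]
    refine setIntegral_nonneg measurableSet_strip fun p hp => ?_
    have hsθ : 0 < Real.sin (2 * p.2) := Real.sin_pos_of_pos_of_lt_pi (by linarith [hp.2.1]) (by linarith [hp.2.2])
    exact mul_nonneg (sq_nonneg _) (Real.rpow_nonneg hsθ.le _)
  have hY0 : 0 ≤ Y := by
    simp only [hY]
    refine setIntegral_nonneg measurableSet_strip fun p hp => ?_
    have hsθ : 0 < Real.sin (2 * p.2) := Real.sin_pos_of_pos_of_lt_pi (by linarith [hp.2.1]) (by linarith [hp.2.2])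
    exact mul_nonneg (sq_nonneg _) (Real.rpow_nonneg hsθ.le _)
  have hαA : α * A ≤ 1 / 10 ^ 14 * A := mul_le_mul_of_nonneg_right hα14 hA0
  have hαY : α * Y ≤ 1 / 10 ^ 14 * Y := mul_le_mul_of_nonneg_right hα14 hY0
  nlinarith [h67, h64, h65, hYw, hαA, hαY, hA0, hX0, hY0]

end Elgindi

end Literature.Analysis.FluidPDE
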